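import Mathlib
import Summits.ABC.ABC.Theorems.SoloInformedLatticeBoxCount
import Summits.ABC.ABC.Theorems.SoloInformedRelationLattice

/-!
# The floor of the two-logarithm method (solo-ABC-informed, s8, Theorem E)

Sharpest-statement artefact for `Summit.ABC` (family `abc`, soloist `solo-ABC-informed`, paper
§2.2(i)/§2.3).  Context.  *Theorem A* of the paper is the sharp two-logarithm `p`-adic bound of
Bugeaud–Laurent (J. Number Theory 61 (1996), Théorème 1 with `γ = 1/2`, over `ℚ_p`), typed
verbatim as the hypothesis `hA` of `SoloInformedTheoremBCore.lean`: for multiplicatively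
independent `p`-units `α₁, α₂ ∈ ℚ` with `log H(αᵢ) ≤ hᵢ` and every admissible parameter tuple
`(K, L, R₁, R₂, S₁, S₂)` it certifies `v_p(α₁^{b₁} - α₂^{b₂}) ≤ K·L - 1/2`.  Admissibility
contains the *zero-estimate condition* (1b): some class of `(r, s) ∈ [0,R₂) × [0,S₂)` modulo the
relation `ᾱ₁^r ᾱ₂^s = const` in `𝔽_p` has more than `(K-1)·L` elements, and the *analytic
condition* (2), which forces `L·((R₂-1)h₁ + (S₂-1)h₂) < 2K(L-1)·log p`.  *Theorem B*
(`soloInformed_theoremB`) chose parameters and obtained `W(p) ≤ 100·g·a₁a₂ + 4` with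
`g = |⟨ᾱ₁, ᾱ₂⟩|`; the paper asked whether the factor `g` and the product of the two heights are
artefacts of that choice (doors (Y_e) and (σ) of the obstruction atlas).

**Theorem E** (`soloInformed_twoLog_floor`, this file) answers no: for `p ≥ 2^13` and *every*
parameter tuple satisfying (1b) and (2) one has

  `g · h₁ · h₂ < 10 · K · (log p)²`,   where `g = |⟨ᾱ₁, ᾱ₂⟩| ≤ p - 1`,

hence the certified quantity obeys `K·L - 1/2 > g·h₁h₂ / (5 (log p)²) - 1/2`
(`soloInformed_twoLog_floor_bound`; `soloInformed_twoLog_floor_hA` is the version with the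
hypotheses of `hA` copied verbatim).  So inside Theorem A the dependence on `g` is linear and the
dependence on the heights is multiplicative for all parameter choices: Theorem B is optimal within
the method up to the numerical constant, and the doors (Y_e) (sub-linear dependence on the order
`e = ord_p 2 ≤ g`) and (σ) (replacing `h₁h₂` by something smaller) are closed *within* the
two-logarithm interpolation-determinant method as published.  Nothing here is a statement about
`abc`; it is a certified constraint on the tool.

Proof.  The exponent pairs of the large class in (1b) form a set `F ⊆ [0,R₂) × [0,S₂)` whose
differences lie in the relation lattice `Λ = {(m,n) : ᾱ₁^m ᾱ₂^n = 1}` (the arithmetic of `Λ`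
is in `SoloInformedRelationLattice.lean`).  (i) Liouville
(`soloInformed_liouville_relation`): a non-trivial relation costs height, `|m|h₁ + |n|h₂ ≥ log(p/2)`,
because `α₁^m α₂^n - 1` is a non-zero rational with numerator divisible by `p`.  (ii) Index
(`soloInformed_card_closure_dvd_det`): every `2 × 2` determinant of relations is divisible by
`g = |⟨ᾱ₁, ᾱ₂⟩|` (the group is cyclic).  (iii) The lattice-class box count
`soloInformed_lattice_class_box_count` then gives `(K-1)L < #F ≤ 2T²/(g h₁h₂) + T/log(p/2) + 1`
with `T = (R₂-1)h₁ + (S₂-1)h₂ < 2K(L-1) log p / L`, and an elementary optimisation in `K ≥ 3`,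
`L ≥ 2` (`soloInformed_floor_endgame`) yields the claim.

References: Y. Bugeaud, M. Laurent, *Minoration effective de la distance p-adique entre puissances
de nombres algébriques*, J. Number Theory 61 (1996) 311–342, Théorème 1 and its conditions (1),
(2); paper.md §2.2(i), §2.3 of the soloist's sharpest statement.
-/

open Finset Real

namespace Summit.ABC.ABC.Theorems

section Floor

variable {p : ℕ} [hp : Fact p.Prime]

/-- **Theorem E (floor of the two-logarithm method).**  Let `p ≥ 2^13`, let `α₁, α₂ ∈ ℚˣ` be
multiplicatively independent `p`-units with `log H(αᵢ) ≤ hᵢ`, reductions `u₁, u₂ ∈ 𝔽_pˣ`, and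
`g = |⟨u₁, u₂⟩|`.  If a parameter tuple satisfies the zero-estimate condition (1b) and the
(consequence of the) analytic condition (2) of Theorem A (`hA` of `SoloInformedTheoremBCore`), then
`g · h₁ · h₂ < 10 · K · (log p)²`. [new: solo-ABC-informed s8] -/
theorem soloInformed_twoLog_floor (hp13 : 2 ^ 13 ≤ p)
    (α₁ α₂ : ℚ) (hα₁ : α₁ ≠ 0) (hα₂ : α₂ ≠ 0)
    (hv₁ : padicValRat p α₁ = 0) (hv₂ : padicValRat p α₂ = 0)
    (hind : ∀ m n : ℤ, α₁ ^ m * α₂ ^ n = 1 → m = 0 ∧ n = 0)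
    (h₁ h₂ : ℝ) (hh₁ : Real.log (max (α₁.num.natAbs : ℝ) (α₁.den : ℝ)) ≤ h₁)
    (hh₂ : Real.log (max (α₂.num.natAbs : ℝ) (α₂.den : ℝ)) ≤ h₂)
    (u₁ u₂ : (ZMod p)ˣ) (hu₁ : (u₁ : ZMod p) = (α₁ : ZMod p)) (hu₂ : (u₂ : ZMod p) = (α₂ : ZMod p))
    (K L R₁ R₂ S₁ S₂ b₁ b₂ : ℕ) (hK : 3 ≤ K) (hL : 2 ≤ L) (hR₁ : 1 ≤ R₁) (hR₂ : 1 ≤ R₂)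
    (hS₁ : 1 ≤ S₁) (hS₂ : 1 ≤ S₂)
    (h1b : ∃ κ : ZMod p, (K - 1) * L < (((Finset.range R₂ ×ˢ Finset.range S₂).filter
      (fun rs : ℕ × ℕ => (α₁ : ZMod p) ^ rs.1 * (α₂ : ZMod p) ^ rs.2 = κ)).image
      (fun rs : ℕ × ℕ => rs.1 * b₂ + rs.2 * b₁)).card)
    (h2 : (L : ℝ) / 2 * (((R₁ : ℝ) + R₂ - 2) * h₁ + ((S₁ : ℝ) + S₂ - 2) * h₂)
      < (K : ℝ) * (L - 1) * Real.log p) :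
    (Nat.card (Subgroup.closure ({u₁, u₂} : Set (ZMod p)ˣ)) : ℝ) * h₁ * h₂
      < 10 * K * (Real.log p) ^ 2 := by
  classical
  have hpp : p.Prime := hp.out
  obtain ⟨κ, hκ⟩ := h1b
  set a₁ : ZMod p := (α₁ : ZMod p) with ha₁def
  set a₂ : ZMod p := (α₂ : ZMod p) with ha₂def
  have ha₁ : a₁ ≠ 0 := by rw [← hu₁]; exact u₁.ne_zero
  have ha₂ : a₂ ≠ 0 := by rw [← hu₂]; exact u₂.ne_zero
  set H := Subgroup.closure ({u₁, u₂} : Set (ZMod p)ˣ) with hHdef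
  have hG0 : 0 < Nat.card H := Nat.card_pos
  -- real constants
  have hp2 : (8192 : ℝ) ≤ p := by
    have : (8192 : ℕ) ≤ p := by norm_num at hp13; exact hp13
    exact_mod_cast this
  have hlog2 : 0 < Real.log 2 := Real.log_pos (by norm_num)
  have hP13 : 13 * Real.log 2 ≤ Real.log p := by
    have h := Real.log_le_log (by norm_num : (0 : ℝ) < 2 ^ 13) (by norm_num; exact hp2)
    rwa [Real.log_pow] at h
  set lam : ℝ := Real.log p - Real.log 2 with hlamdef
  have hlam : 0 < lam := by rw [hlamdef]; linarith
  have hPlam : 12 * Real.log p ≤ 13 * lam := by rw [hlamdef]; linarith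
  -- heights are at least `log 2`
  have hne1 : ∀ {α β : ℚ}, (∀ m n : ℤ, α ^ m * β ^ n = 1 → m = 0 ∧ n = 0) → α ≠ 1 ∧ α ≠ -1 := by
    intro α β hI
    constructor
    · intro h
      have := (hI 1 0 (by rw [h]; simp)).1
      exact one_ne_zero this
    · intro h
      have := (hI 2 0 (by rw [h]; norm_num)).1
      norm_num at this
  have hind' : ∀ m n : ℤ, α₂ ^ m * α₁ ^ n = 1 → m = 0 ∧ n = 0 := by
    intro m n h
    have := hind n m (by rw [mul_comm]; exact h)
    exact ⟨this.2, this.1⟩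
  obtain ⟨hα₁1, hα₁m1⟩ := hne1 hind
  obtain ⟨hα₂1, hα₂m1⟩ := hne1 hind'
  have hH₁ : (2 : ℝ) ≤ max (α₁.num.natAbs : ℝ) (α₁.den : ℝ) := by
    have := soloInformed_two_le_height α₁ hα₁ hα₁1 hα₁m1
    have h' : ((2 : ℕ) : ℝ) ≤ ((max α₁.num.natAbs α₁.den : ℕ) : ℝ) := by exact_mod_cast this
    push_cast at h'
    exact h'
  have hH₂ : (2 : ℝ) ≤ max (α₂.num.natAbs : ℝ) (α₂.den : ℝ) := by
    have := soloInformed_two_le_height α₂ hα₂ hα₂1 hα₂m1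
    have h' : ((2 : ℕ) : ℝ) ≤ ((max α₂.num.natAbs α₂.den : ℕ) : ℝ) := by exact_mod_cast this
    push_cast at h'
    exact h'
  have hlogH₁ : Real.log 2 ≤ Real.log (max (α₁.num.natAbs : ℝ) (α₁.den : ℝ)) :=
    Real.log_le_log (by norm_num) hH₁
  have hlogH₂ : Real.log 2 ≤ Real.log (max (α₂.num.natAbs : ℝ) (α₂.den : ℝ)) :=
    Real.log_le_log (by norm_num) hH₂
  have hh₁pos : 0 < h₁ := by linarith
  have hh₂pos : 0 < h₂ := by linarith
  -- the large class `F₀` and its copy `F` in `ℤ × ℤ`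
  set F₀ : Finset (ℕ × ℕ) := (Finset.range R₂ ×ˢ Finset.range S₂).filter
      (fun rs : ℕ × ℕ => a₁ ^ rs.1 * a₂ ^ rs.2 = κ) with hF₀def
  have hF₀card : (K - 1) * L < F₀.card := lt_of_lt_of_le hκ Finset.card_image_le
  have hF₀mem : ∀ rs ∈ F₀, (rs.1 < R₂ ∧ rs.2 < S₂) ∧ a₁ ^ rs.1 * a₂ ^ rs.2 = κ := by
    intro rs hrs
    simpa [hF₀def, Finset.mem_filter, Finset.mem_product, Finset.mem_range] using hrs
  have hκ0 : κ ≠ 0 := by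
    have hne : F₀.Nonempty := by
      rw [← Finset.card_pos]; omega
    obtain ⟨rs, hrs⟩ := hne
    rw [← (hF₀mem rs hrs).2]
    exact mul_ne_zero (pow_ne_zero _ ha₁) (pow_ne_zero _ ha₂)
  set ι : ℕ × ℕ → ℤ × ℤ := fun rs => ((rs.1 : ℤ), (rs.2 : ℤ)) with hιdef
  have hιinj : Function.Injective ι := by
    intro x y hxy
    simp only [hιdef, Prod.mk.injEq, Nat.cast_inj] at hxy
    exact Prod.ext hxy.1 hxy.2
  set F : Finset (ℤ × ℤ) := F₀.image ι with hFdef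
  have hFcard : F.card = F₀.card := Finset.card_image_of_injective _ hιinj
  -- the relation lattice
  set Λ : Set (ℤ × ℤ) := {v | a₁ ^ v.1 * a₂ ^ v.2 = 1} with hΛdef
  have hΛ : ∀ v : ℤ × ℤ, v ∈ Λ ↔ a₁ ^ v.1 * a₂ ^ v.2 = 1 := fun v => Iff.rfl
  have hsub : ∀ v ∈ Λ, ∀ w ∈ Λ, v - w ∈ Λ := by
    intro v hv w hw
    rw [hΛ] at hv hw ⊢
    rw [Prod.fst_sub, Prod.snd_sub, zpow_sub₀ ha₁, zpow_sub₀ ha₂, div_mul_div_comm, hv, hw,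
      div_one]
  have hsmul : ∀ (k : ℤ), ∀ v ∈ Λ, k • v ∈ Λ := by
    intro k v hv
    rw [hΛ] at hv ⊢
    rw [Prod.smul_fst, Prod.smul_snd, smul_eq_mul, smul_eq_mul, zpow_mul', zpow_mul',
      ← mul_zpow, hv, one_zpow]
  have hLiou : ∀ v ∈ Λ, v ≠ 0 → lam ≤ |(v.1 : ℝ)| * h₁ + |(v.2 : ℝ)| * h₂ := by
    intro v hv hv0
    have hmn : ¬ (v.1 = 0 ∧ v.2 = 0) := fun h => hv0 (Prod.ext h.1 h.2)
    have := soloInformed_liouville_relation α₁ α₂ hα₁ hα₂ hv₁ hv₂ hind v.1 v.2 hmn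
      ((hΛ v).mp hv)
    have e1 := mul_le_mul_of_nonneg_left hh₁ (abs_nonneg (v.1 : ℝ))
    have e2 := mul_le_mul_of_nonneg_left hh₂ (abs_nonneg (v.2 : ℝ))
    rw [hlamdef]
    linarith
  have hunit : ∀ v ∈ Λ, u₁ ^ v.1 * u₂ ^ v.2 = 1 := by
    intro v hv
    rw [hΛ] at hv
    rw [← Units.val_eq_one, Units.val_mul, Units.val_zpow_eq_zpow_val,
      Units.val_zpow_eq_zpow_val, hu₁, hu₂]
    exact hv
  have hdet : ∀ v ∈ Λ, ∀ w ∈ Λ, (Nat.card H : ℤ) ∣ v.1 * w.2 - v.2 * w.1 := by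
    intro v hv w hw
    exact soloInformed_card_closure_dvd_det u₁ u₂ (hunit v hv) (hunit w hw)
  have hbox : ∀ u ∈ F, 0 ≤ u.1 ∧ u.1 ≤ (R₂ : ℤ) - 1 ∧ 0 ≤ u.2 ∧ u.2 ≤ (S₂ : ℤ) - 1 := by
    intro u hu
    obtain ⟨rs, hrs, rfl⟩ := Finset.mem_image.mp hu
    obtain ⟨⟨hr, hs⟩, -⟩ := hF₀mem rs hrs
    simp only [hιdef]
    omega
  have hcos : ∀ u ∈ F, ∀ u' ∈ F, u - u' ∈ Λ := by
    intro u hu u' hu'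
    obtain ⟨rs, hrs, rfl⟩ := Finset.mem_image.mp hu
    obtain ⟨rs', hrs', rfl⟩ := Finset.mem_image.mp hu'
    have e := (hF₀mem rs hrs).2
    have e' := (hF₀mem rs' hrs').2
    rw [hΛ]
    simp only [hιdef, Prod.fst_sub, Prod.snd_sub]
    rw [zpow_sub₀ ha₁, zpow_sub₀ ha₂, zpow_natCast, zpow_natCast, zpow_natCast, zpow_natCast,
      div_mul_div_comm, e, e', div_self hκ0]
  -- the count
  have hcount := soloInformed_lattice_class_box_count Λ hsub hsmul hh₁pos hh₂pos hlam hLiou hG0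
    hdet hR₂ hS₂ F hbox hcos
  -- lower bound for `#F`
  have hK1 : 1 ≤ K := by omega
  have hlow : ((K : ℝ) - 1) * L + 1 ≤ (F.card : ℝ) := by
    have h' : (K - 1) * L + 1 ≤ F.card := by rw [hFcard]; exact hF₀card
    have h'' : (((K - 1) * L + 1 : ℕ) : ℝ) ≤ (F.card : ℝ) := by exact_mod_cast h'
    rw [Nat.cast_add, Nat.cast_mul, Nat.cast_sub hK1, Nat.cast_one] at h''
    exact h''
  -- abbreviations
  set W : ℝ := (Nat.card H : ℝ) * h₁ * h₂ with hWdef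
  set T : ℝ := ((R₂ : ℝ) - 1) * h₁ + ((S₂ : ℝ) - 1) * h₂ with hTdef
  have hG1 : (1 : ℝ) ≤ Nat.card H := by exact_mod_cast hG0
  have hW : 0 < W := by positivity
  have hR₁' : (1 : ℝ) ≤ R₁ := by exact_mod_cast hR₁
  have hS₁' : (1 : ℝ) ≤ S₁ := by exact_mod_cast hS₁
  have hR₂' : (1 : ℝ) ≤ R₂ := by exact_mod_cast hR₂
  have hS₂' : (1 : ℝ) ≤ S₂ := by exact_mod_cast hS₂
  have hT0 : 0 ≤ T := by
    rw [hTdef]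
    have := mul_nonneg (by linarith : (0 : ℝ) ≤ (R₂ : ℝ) - 1) hh₁pos.le
    have := mul_nonneg (by linarith : (0 : ℝ) ≤ (S₂ : ℝ) - 1) hh₂pos.le
    linarith
  have hKr : (3 : ℝ) ≤ K := by exact_mod_cast hK
  have hLr : (2 : ℝ) ≤ L := by exact_mod_cast hL
  -- `L T < 2 K (L-1) log p`
  have hT : (L : ℝ) * T < 2 * K * (L - 1) * Real.log p := by
    have hbig : T ≤ ((R₁ : ℝ) + R₂ - 2) * h₁ + ((S₁ : ℝ) + S₂ - 2) * h₂ := by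
      rw [hTdef]
      have := mul_nonneg (by linarith : (0 : ℝ) ≤ (R₁ : ℝ) - 1) hh₁pos.le
      have := mul_nonneg (by linarith : (0 : ℝ) ≤ (S₁ : ℝ) - 1) hh₂pos.le
      linarith
    have := mul_le_mul_of_nonneg_left hbig (by linarith : (0 : ℝ) ≤ L)
    linarith
  -- `(K-1) L W lam ≤ 2 T² lam + T W`
  have hstar : ((K : ℝ) - 1) * L * W * lam ≤ 2 * T ^ 2 * lam + T * W := by
    have hc : ((K : ℝ) - 1) * L ≤ 2 * T ^ 2 / W + T / lam := by
      have : (F.card : ℝ) ≤ 2 * T ^ 2 / W + T / lam + 1 := by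
        rw [hWdef, hTdef]; exact hcount
      linarith
    have := mul_le_mul_of_nonneg_right hc (by positivity : (0 : ℝ) ≤ W * lam)
    have e : (2 * T ^ 2 / W + T / lam) * (W * lam) = 2 * T ^ 2 * lam + T * W := by
      field_simp
    calc ((K : ℝ) - 1) * L * W * lam = ((K : ℝ) - 1) * L * (W * lam) := by ring
      _ ≤ (2 * T ^ 2 / W + T / lam) * (W * lam) := this
      _ = 2 * T ^ 2 * lam + T * W := e
  exact soloInformed_floor_endgame hKr hLr hW hlam hPlam hT0 hT hstar

/-- Theorem E in the form "the certified bound has a floor": under the hypotheses of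
`soloInformed_twoLog_floor`, `K·L - 1/2 > g·h₁h₂/(5 (log p)²) - 1/2`. [new: solo-ABC-informed s8] -/
theorem soloInformed_twoLog_floor_bound (hp13 : 2 ^ 13 ≤ p)
    (α₁ α₂ : ℚ) (hα₁ : α₁ ≠ 0) (hα₂ : α₂ ≠ 0)
    (hv₁ : padicValRat p α₁ = 0) (hv₂ : padicValRat p α₂ = 0)
    (hind : ∀ m n : ℤ, α₁ ^ m * α₂ ^ n = 1 → m = 0 ∧ n = 0)
    (h₁ h₂ : ℝ) (hh₁ : Real.log (max (α₁.num.natAbs : ℝ) (α₁.den : ℝ)) ≤ h₁)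
    (hh₂ : Real.log (max (α₂.num.natAbs : ℝ) (α₂.den : ℝ)) ≤ h₂)
    (u₁ u₂ : (ZMod p)ˣ) (hu₁ : (u₁ : ZMod p) = (α₁ : ZMod p)) (hu₂ : (u₂ : ZMod p) = (α₂ : ZMod p))
    (K L R₁ R₂ S₁ S₂ b₁ b₂ : ℕ) (hK : 3 ≤ K) (hL : 2 ≤ L) (hR₁ : 1 ≤ R₁) (hR₂ : 1 ≤ R₂)
    (hS₁ : 1 ≤ S₁) (hS₂ : 1 ≤ S₂)
    (h1b : ∃ κ : ZMod p, (K - 1) * L < (((Finset.range R₂ ×ˢ Finset.range S₂).filter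
      (fun rs : ℕ × ℕ => (α₁ : ZMod p) ^ rs.1 * (α₂ : ZMod p) ^ rs.2 = κ)).image
      (fun rs : ℕ × ℕ => rs.1 * b₂ + rs.2 * b₁)).card)
    (h2 : (L : ℝ) / 2 * (((R₁ : ℝ) + R₂ - 2) * h₁ + ((S₁ : ℝ) + S₂ - 2) * h₂)
      < (K : ℝ) * (L - 1) * Real.log p) :
    (Nat.card (Subgroup.closure ({u₁, u₂} : Set (ZMod p)ˣ)) : ℝ) * h₁ * h₂
        / (5 * (Real.log p) ^ 2) - 1 / 2 < (K : ℝ) * L - 1 / 2 := by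
  have hE := soloInformed_twoLog_floor hp13 α₁ α₂ hα₁ hα₂ hv₁ hv₂ hind h₁ h₂ hh₁ hh₂ u₁ u₂ hu₁ hu₂
    K L R₁ R₂ S₁ S₂ b₁ b₂ hK hL hR₁ hR₂ hS₁ hS₂ h1b h2
  have hp2 : (2 : ℝ) ≤ p := by exact_mod_cast hp.out.two_le
  have hP : 0 < Real.log p := Real.log_pos (by linarith)
  have hKr : (3 : ℝ) ≤ K := by exact_mod_cast hK
  have hLr : (2 : ℝ) ≤ L := by exact_mod_cast hL
  have h5 : 0 < 5 * (Real.log p) ^ 2 := by positivity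
  have hKP : 0 < (K : ℝ) * (Real.log p) ^ 2 := by positivity
  have hmain : (Nat.card (Subgroup.closure ({u₁, u₂} : Set (ZMod p)ˣ)) : ℝ) * h₁ * h₂
      / (5 * (Real.log p) ^ 2) < (K : ℝ) * L := by
    rw [div_lt_iff₀ h5]
    have := mul_le_mul_of_nonneg_right hLr hKP.le
    nlinarith
  linarith

/-- Theorem E with the hypotheses of Theorem A (`hA` of `SoloInformedTheoremBCore`) copied
verbatim: conditions (1a), (1b), (2) of Bugeaud–Laurent for a parameter tuple imply
`g·h₁·h₂ < 10·K·(log p)²` (`p ≥ 2^13`). [new: solo-ABC-informed s8] -/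
theorem soloInformed_twoLog_floor_hA (hp13 : 2 ^ 13 ≤ p)
    (α₁ α₂ : ℚ) (hα₁ : α₁ ≠ 0) (hα₂ : α₂ ≠ 0)
    (hv₁ : padicValRat p α₁ = 0) (hv₂ : padicValRat p α₂ = 0)
    (hind : ∀ m n : ℤ, α₁ ^ m * α₂ ^ n = 1 → m = 0 ∧ n = 0)
    (h₁ h₂ : ℝ) (hh₁ : Real.log (max (α₁.num.natAbs : ℝ) (α₁.den : ℝ)) ≤ h₁)
    (hh₂ : Real.log (max (α₂.num.natAbs : ℝ) (α₂.den : ℝ)) ≤ h₂)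
    (u₁ u₂ : (ZMod p)ˣ) (hu₁ : (u₁ : ZMod p) = (α₁ : ZMod p)) (hu₂ : (u₂ : ZMod p) = (α₂ : ZMod p))
    (K L R₁ R₂ S₁ S₂ b₁ b₂ : ℕ) (hK : 3 ≤ K) (hL : 2 ≤ L) (hR₁ : 1 ≤ R₁) (hR₂ : 1 ≤ R₂)
    (hS₁ : 1 ≤ S₁) (hS₂ : 1 ≤ S₂)
    (h1a : (1 : ℝ) ≤ (((R₁ : ℝ) + R₂ - 2) * b₂ + ((S₁ : ℝ) + S₂ - 2) * b₁) / 2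
      * (∏ k ∈ Finset.range K, (k.factorial : ℝ)) ^ (-(2 : ℝ) / ((K : ℝ) ^ 2 - K)))
    (h1b : ∃ κ : ZMod p, (K - 1) * L < (((Finset.range R₂ ×ˢ Finset.range S₂).filter
      (fun rs : ℕ × ℕ => (α₁ : ZMod p) ^ rs.1 * (α₂ : ZMod p) ^ rs.2 = κ)).image
      (fun rs : ℕ × ℕ => rs.1 * b₂ + rs.2 * b₁)).card)
    (h2 : 3 * Real.log ((K : ℝ) * L)
      + ((K : ℝ) - 1) * Real.log ((((R₁ : ℝ) + R₂ - 2) * b₂ + ((S₁ : ℝ) + S₂ - 2) * b₁) / 2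
          * (∏ k ∈ Finset.range K, (k.factorial : ℝ)) ^ (-(2 : ℝ) / ((K : ℝ) ^ 2 - K)))
      + (L : ℝ) / 2 * (((R₁ : ℝ) + R₂ - 2) * h₁ + ((S₁ : ℝ) + S₂ - 2) * h₂)
      < (K : ℝ) * (L - 1) * Real.log p) :
    (Nat.card (Subgroup.closure ({u₁, u₂} : Set (ZMod p)ˣ)) : ℝ) * h₁ * h₂
      < 10 * K * (Real.log p) ^ 2 := by
  have hKr : (3 : ℝ) ≤ K := by exact_mod_cast hK
  have hLr : (2 : ℝ) ≤ L := by exact_mod_cast hL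
  have hKL : (1 : ℝ) ≤ (K : ℝ) * L := by nlinarith
  have hlog1 : 0 ≤ Real.log ((K : ℝ) * L) := Real.log_nonneg hKL
  have hlog2 : 0 ≤ Real.log ((((R₁ : ℝ) + R₂ - 2) * b₂ + ((S₁ : ℝ) + S₂ - 2) * b₁) / 2
      * (∏ k ∈ Finset.range K, (k.factorial : ℝ)) ^ (-(2 : ℝ) / ((K : ℝ) ^ 2 - K))) :=
    Real.log_nonneg h1a
  have hprod : 0 ≤ ((K : ℝ) - 1) * Real.log ((((R₁ : ℝ) + R₂ - 2) * b₂
      + ((S₁ : ℝ) + S₂ - 2) * b₁) / 2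
      * (∏ k ∈ Finset.range K, (k.factorial : ℝ)) ^ (-(2 : ℝ) / ((K : ℝ) ^ 2 - K))) :=
    mul_nonneg (by linarith) hlog2
  have h2' : (L : ℝ) / 2 * (((R₁ : ℝ) + R₂ - 2) * h₁ + ((S₁ : ℝ) + S₂ - 2) * h₂)
      < (K : ℝ) * (L - 1) * Real.log p := by linarith
  exact soloInformed_twoLog_floor hp13 α₁ α₂ hα₁ hα₂ hv₁ hv₂ hind h₁ h₂ hh₁ hh₂ u₁ u₂ hu₁ hu₂
    K L R₁ R₂ S₁ S₂ b₁ b₂ hK hL hR₁ hR₂ hS₁ hS₂ h1b h2'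

end Floor

end Summit.ABC.ABC.Theorems
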